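import Summits.BirchSwinnertonDyer.Rank1Residual.Additive.QuadraticBaseChangeCardIdentityCanonicalModel
import HarnessLib

/-!
# The Tamagawa–unit and card identities of Milne's quadratic quotient in the CANONICAL-MODEL
# currency, POPULATION-FREE: from the per-place fibre identities (T) as a hypothesis
# (row T-MIL-CAN, FILE 3; seat n1011-p16 GEN 10)

HONEST FRAMING (cell `b2b-bsdres`, run/shared/lean/b2b/bsd-rank1-residual/, verbatim in every
file): the goal of the cell is to DELETE the COMBINATION-SHAPED residual classes of the
Birch–Swinnerton-Dyer formula for ALL analytic-rank `≤ 1` elliptic curves over `ℚ` — "full BSD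
formula for every rank `≤ 1` curve in class `C`" assembled STRICTLY from published theorems — so
that the rank-`≤ 1` remainder becomes exactly the CONSTRUCTION-SHAPED classes, which are TYPED
(missing-input `Prop`s), NOT attempted. This is not "finishing BSD". X3 / X4 (here the `K = ℚ(ζ₃)`
lines of X4♯(G-ord) / X3♯(G-ord) at `p = 3`) are RESEARCH ROUTES; they stay CONSTRUCTION-SHAPED;
nothing is booked by this file; no mark / label moved. THEOREMS ONLY: no definition, no named fact,
no `sorry`.

## What

FILES 1–2 of row T-MIL-CAN (`QuadraticBaseChangeTamagawaCanonicalModel`,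
`…CardIdentityCanonicalModel`) state the odd part of Milne's identity in Dokchitser–Dokchitser's
`C(V ⊗ K)` currency on the population S₁ (hypothesis `hS`).  The population enters ONLY through the
per-place fibre identities (T) `Σ_{w ∣ v} v_p c_w(V_K) = v_p c_v(V) + v_p c_v(W)`, which FILE 1 §1's
schema `padicValNat_tamagawaProduct_eq_add_of_sum_fibre` already abstracts.  This file restates the
three downstream identities with (T) ITSELF as the hypothesis `hT`, so that every population for
which (T) is a theorem plugs in by a one-liner — S₁ (n1011-p01 `…_of_semistable'`), S₂/S₃ at odd
`p` (n1011-p01 T-MIL-3 H-1 + row T-A233's `_holds`), the inert-`2` IV/IV* entries (row T-MIL-B2):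

* `padicValRat_modifiedTamagawaProduct_baseChange_eq_of_sumFibre` —
  `v_p C(V⊗K) = v_p(|u_C|·∏c(V)·∏c(W))` (`V` good or multiplicative at `p`, `d_K` squarefree, `p` odd);
* `padicVal_card_identity_baseChange_anyRank_of_sumFibre` — the any-rank valuation identity;
* `padicVal_card_identity_baseChange_of_sumFibre` — the rank-`(0,0)` valuation identity.

HONEST LIMITS: nothing about which places satisfy (T); closes no class; moves no mark; 0 facts.

References: [cite: Milne1972ArithmeticAV, §1 Thm. 1 and §2] through
[cite: DokchitserDokchitserAnnals2010, §2.1, Lemma 4.14]; [cite: SilvermanAEC2009, Exercise 10.16].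
-/

noncomputable section

open scoped Classical NumberField

open WeierstrassCurve NumberField IsDedekindDomain Rat.HeightOneSpectrum
  Literature.NumberTheory.QuadraticFields
  Summit.BirchSwinnertonDyer.Rank1Residual.AdditivePotMult

namespace Summit.BirchSwinnertonDyer.Rank1Residual.Additive

section SumFibre

variable (K : Type) [Field K] [NumberField K]
  (V : WeierstrassCurve ℚ) [V.IsElliptic] [V.IsGloballyMinimal]
  (W : WeierstrassCurve ℚ) [W.IsElliptic] [W.IsGloballyMinimal] (p : ℕ) [hp : Fact p.Prime]

/-- **`v_p C(V ⊗ K) = v_p(|u_C| · ∏c(V) · ∏c(W))` from the fibre identities (T)** (`K` quadratic with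
`d_K` squarefree, `W = C • V^{(d_K)}`, `p` odd, `V` good or multiplicative at `p`): FILE 1's
`…_of_semistable` with the population replaced by (T) itself.
[cite: Milne1972ArithmeticAV, §1 Thm. 1 and §2 (through DokchitserDokchitserAnnals2010, §2.1, proof of Thm. 8)]
[cite: DokchitserDokchitserAnnals2010, §1 Notation (arXiv pp. 4–5)] -/
theorem padicValRat_modifiedTamagawaProduct_baseChange_eq_of_sumFibre
    (hdsq : Squarefree (NumberField.discr K))
    {C : VariableChange ℚ} (hC : C • V.quadraticTwist (NumberField.discr K : ℚ) = W) (hp2 : p ≠ 2)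
    (hT : ∀ v : HeightOneSpectrum (𝓞 ℚ),
      ∑ w ∈ (HeightOneSpectrum.finite_setOf_under_eq_of_numberField (K := K) v).toFinset,
          padicValNat p (((V.baseChange K).baseChange (w.adicCompletion K)).localTamagawaNumber
            (w.adicCompletionIntegers K)) =
        padicValNat p ((V.baseChange (v.adicCompletion ℚ)).localTamagawaNumber
            (v.adicCompletionIntegers ℚ)) +
          padicValNat p ((W.baseChange (v.adicCompletion ℚ)).localTamagawaNumber
            (v.adicCompletionIntegers ℚ)))
    (h₀ : V.HasGoodReductionAtPrime p ∨ V.HasMultiplicativeReductionAtPrime p) :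
    padicValRat p (V.baseChange K).modifiedTamagawaProduct =
      padicValRat p (|(C.u : ℚ)| * (V.tamagawaProduct * W.tamagawaProduct) : ℚ) := by
  haveI : (V.baseChange K).IsElliptic := by rw [baseChange]; infer_instance
  have hM : padicValRat p (V.baseChange K).modifiedTamagawaProduct =
      padicValNat p (V.baseChange K).tamagawaProduct := by
    rcases h₀ with hg | hm
    · exact padicValRat_modifiedTamagawaProduct_baseChange V p
        (fun hdvd ↦ V.not_hasGoodReductionAtPrime_of_dvd_minimalDiscriminantInt p hdvd hg)
    · exact padicValRat_modifiedTamagawaProduct_baseChange_of_mult V p hm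
  have hu : |(C.u : ℚ)| ≠ 0 := abs_ne_zero.mpr (C.u).ne_zero
  have hcV : (V.tamagawaProduct : ℚ) ≠ 0 := by exact_mod_cast V.tamagawaProduct_pos'.ne'
  have hcW : (W.tamagawaProduct : ℚ) ≠ 0 := by exact_mod_cast W.tamagawaProduct_pos'.ne'
  rw [hM, padicValNat_tamagawaProduct_eq_add_of_sum_fibre V W (V.baseChange K) p hT,
    padicValRat.mul hu (mul_ne_zero hcV hcW), padicValRat.mul hcV hcW,
    padicValRat_abs_u_eq_zero_of_good_or_mult K V W p hdsq hC hp2 h₀, padicValRat.of_nat,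
    padicValRat.of_nat]
  push_cast
  ring

/-- **The ANY-RANK valuation identity of the canonical-model `K`-side from (T)**:
`v_p C(V⊗K) + v_p #Ш(V_K) + 2v_p #V(ℚ)_tors + 2v_p #W(ℚ)_tors = v_p|u_C| + v_p #Ш(V) + v_p #Ш(W)
+ v_p ∏c(V) + v_p ∏c(W) + 2v_p #V(K)_tors` (`[K:ℚ] = 2`, `d_K` squarefree, `p` odd, `V` good or
multiplicative at `p`, `Ш(V)`, `Ш(W)` finite) — FILE 2's `…_anyRank_of_semistable` with the population
replaced by (T). [cite: Milne1972ArithmeticAV, §1 Thm. 1 and §2 (through DokchitserDokchitserAnnals2010, §2.1, proof of Thm. 8)]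
[cite: DokchitserDokchitserAnnals2010, Lemma 4.14 (proof)] [cite: SilvermanAEC2009, Exercise 10.16] -/
theorem padicVal_card_identity_baseChange_anyRank_of_sumFibre (h2 : Module.finrank ℚ K = 2)
    (hdsq : Squarefree (NumberField.discr K))
    {C : VariableChange ℚ} (hC : C • V.quadraticTwist (NumberField.discr K : ℚ) = W) (hp2 : p ≠ 2)
    (hT : ∀ v : HeightOneSpectrum (𝓞 ℚ),
      ∑ w ∈ (HeightOneSpectrum.finite_setOf_under_eq_of_numberField (K := K) v).toFinset,
          padicValNat p (((V.baseChange K).baseChange (w.adicCompletion K)).localTamagawaNumber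
            (w.adicCompletionIntegers K)) =
        padicValNat p ((V.baseChange (v.adicCompletion ℚ)).localTamagawaNumber
            (v.adicCompletionIntegers ℚ)) +
          padicValNat p ((W.baseChange (v.adicCompletion ℚ)).localTamagawaNumber
            (v.adicCompletionIntegers ℚ)))
    (h₀ : V.HasGoodReductionAtPrime p ∨ V.HasMultiplicativeReductionAtPrime p)
    (hfinV : V.ShaFinite) (hfinW : W.ShaFinite) :
    padicValRat p (V.baseChange K).modifiedTamagawaProduct + padicValNat p (V.baseChange K).shaOrder +
        2 * padicValNat p V.torsionOrder + 2 * padicValNat p W.torsionOrder =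
      padicValRat p |(C.u : ℚ)| + padicValNat p V.shaOrder + padicValNat p W.shaOrder +
        padicValNat p V.tamagawaProduct + padicValNat p W.tamagawaProduct +
        2 * padicValNat p (V.baseChange K).torsionOrder := by
  have hTam := padicValRat_modifiedTamagawaProduct_baseChange_eq_of_sumFibre K V W p hdsq hC hp2 hT h₀
  have hu : |(C.u : ℚ)| ≠ 0 := abs_ne_zero.mpr (C.u).ne_zero
  have hcV : (V.tamagawaProduct : ℚ) ≠ 0 := by exact_mod_cast V.tamagawaProduct_pos'.ne'
  have hcW : (W.tamagawaProduct : ℚ) ≠ 0 := by exact_mod_cast W.tamagawaProduct_pos'.ne'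
  rw [padicValRat.mul hu (mul_ne_zero hcV hcW), padicValRat.mul hcV hcW, padicValRat.of_nat,
    padicValRat.of_nat] at hTam
  have hSha := padicValNat_shaOrder_baseChange_of_twist K V W p h2 hC hp2 hfinV hfinW
  obtain ⟨θ, c, hθ, hc⟩ := Quadratic.exists_sq_eq_algebraMap (F := ℚ) (K := K) h2
  obtain ⟨q, hq, hd⟩ := NumberField.exists_discr_eq_mul_sq h2 hθ hc
  have hTor := padicValNat_torsionOrder_baseChange_quadratic_anyRank V K h2 hθ hc hq hd W ⟨C, hC⟩ p hp2
  rw [hTam, hSha, hTor]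
  push_cast
  ring

/-- **The rank-`(0,0)` valuation identity from (T)**:
`v_p(C(V⊗K)·#Ш(V_K)·#V(ℚ)²·#W(ℚ)²) = v_p(n_V·|u_C|·#Ш(V)·#Ш(W)·∏c(V)·∏c(W)·#V(K)²)` — FILE 2's
`…_of_semistable` with the population replaced by (T).
[cite: Milne1972ArithmeticAV, §1 Thm. 1 and §2 (through DokchitserDokchitserAnnals2010, §2.1, proof of Thm. 8)]
[cite: DokchitserDokchitserAnnals2010, Lemma 4.14 (proof)] [cite: SilvermanAEC2009, Exercise 10.16] -/
theorem padicVal_card_identity_baseChange_of_sumFibre (h2 : Module.finrank ℚ K = 2)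
    (hdsq : Squarefree (NumberField.discr K))
    {C : VariableChange ℚ} (hC : C • V.quadraticTwist (NumberField.discr K : ℚ) = W) (hp2 : p ≠ 2)
    (hT : ∀ v : HeightOneSpectrum (𝓞 ℚ),
      ∑ w ∈ (HeightOneSpectrum.finite_setOf_under_eq_of_numberField (K := K) v).toFinset,
          padicValNat p (((V.baseChange K).baseChange (w.adicCompletion K)).localTamagawaNumber
            (w.adicCompletionIntegers K)) =
        padicValNat p ((V.baseChange (v.adicCompletion ℚ)).localTamagawaNumber
            (v.adicCompletionIntegers ℚ)) +
          padicValNat p ((W.baseChange (v.adicCompletion ℚ)).localTamagawaNumber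
            (v.adicCompletionIntegers ℚ)))
    (h₀ : V.HasGoodReductionAtPrime p ∨ V.HasMultiplicativeReductionAtPrime p)
    [Finite V.toAffine.Point] [Finite W.toAffine.Point] (hfinV : V.ShaFinite) (hfinW : W.ShaFinite) :
    padicValRat p ((V.baseChange K).modifiedTamagawaProduct * (V.baseChange K).shaOrder *
        (Nat.card V.toAffine.Point) ^ 2 * (Nat.card W.toAffine.Point) ^ 2 : ℚ) =
      padicValRat p ((V.baseChange ℝ).numRealComponents * |(C.u : ℚ)| * V.shaOrder * W.shaOrder *
        V.tamagawaProduct * W.tamagawaProduct * (Nat.card (V.baseChange K).toAffine.Point) ^ 2 : ℚ) := by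
  haveI : (V.baseChange K).IsElliptic := by rw [baseChange]; infer_instance
  haveI : Finite (V.baseChange K).toAffine.Point := finite_point_baseChange_of_twist K V W h2 hC
  set VK := V.baseChange K with hVK
  have hshaK : VK.ShaFinite := shaFinite_baseChange_of_twist K V W h2 hC hfinV hfinW
  have hTam := padicValRat_modifiedTamagawaProduct_baseChange_eq_of_sumFibre K V W p hdsq hC hp2 hT h₀
  have hSha : padicValNat p VK.shaOrder = padicValNat p V.shaOrder + padicValNat p W.shaOrder :=
    V.padicValNat_shaOrder_baseChange_quadratic_of_odd K h2 hC (C' := 1) (one_smul _ _) hshaK p hp2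
  obtain ⟨θ, c, hθ, hc⟩ := Quadratic.exists_sq_eq_algebraMap (F := ℚ) (K := K) h2
  obtain ⟨q, hq, hd⟩ := NumberField.exists_discr_eq_mul_sq h2 hθ hc
  have hMW : padicValNat p (Nat.card VK.toAffine.Point) =
      padicValNat p (Nat.card V.toAffine.Point) + padicValNat p (Nat.card W.toAffine.Point) :=
    V.padicValNat_natCard_point_baseChange_quadratic_of_odd h2 hθ hc hq hd ⟨C, hC⟩
      ⟨(1 : VariableChange K), one_smul _ _⟩ p hp2
  have hu : |(C.u : ℚ)| ≠ 0 := abs_ne_zero.mpr (C.u).ne_zero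
  have hcV : (V.tamagawaProduct : ℚ) ≠ 0 := by exact_mod_cast V.tamagawaProduct_pos'.ne'
  have hcW : (W.tamagawaProduct : ℚ) ≠ 0 := by exact_mod_cast W.tamagawaProduct_pos'.ne'
  have hSV : (V.shaOrder : ℚ) ≠ 0 := by exact_mod_cast (V.shaOrder_pos hfinV).ne'
  have hSW : (W.shaOrder : ℚ) ≠ 0 := by exact_mod_cast (W.shaOrder_pos hfinW).ne'
  have hSK : (VK.shaOrder : ℚ) ≠ 0 := by exact_mod_cast (VK.shaOrder_pos hshaK).ne'
  have hNV : ((Nat.card V.toAffine.Point : ℕ) : ℚ) ≠ 0 := by exact_mod_cast Nat.card_pos.ne'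
  have hNW : ((Nat.card W.toAffine.Point : ℕ) : ℚ) ≠ 0 := by exact_mod_cast Nat.card_pos.ne'
  have hNK : ((Nat.card VK.toAffine.Point : ℕ) : ℚ) ≠ 0 := by exact_mod_cast Nat.card_pos.ne'
  have hn : ((V.baseChange ℝ).numRealComponents : ℚ) ≠ 0 := by
    exact_mod_cast (V.baseChange ℝ).numRealComponents_pos.ne'
  have hM : VK.modifiedTamagawaProduct ≠ 0 := modifiedTamagawaProduct_ne_zero VK
  have hnv : padicValRat p ((V.baseChange ℝ).numRealComponents : ℚ) = 0 :=
    padicValRat_numRealComponents_eq_zero V p hp2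
  rw [hVK] at hM hSK hNK hSha hMW
  rw [padicValRat.mul hu (mul_ne_zero hcV hcW), padicValRat.mul hcV hcW] at hTam
  rw [padicValRat.mul (mul_ne_zero (mul_ne_zero hM hSK) (pow_ne_zero 2 hNV)) (pow_ne_zero 2 hNW),
    padicValRat.mul (mul_ne_zero hM hSK) (pow_ne_zero 2 hNV), padicValRat.mul hM hSK,
    padicValRat.mul (mul_ne_zero (mul_ne_zero (mul_ne_zero (mul_ne_zero (mul_ne_zero hn hu) hSV)
      hSW) hcV) hcW) (pow_ne_zero 2 hNK),
    padicValRat.mul (mul_ne_zero (mul_ne_zero (mul_ne_zero (mul_ne_zero hn hu) hSV) hSW) hcV) hcW,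
    padicValRat.mul (mul_ne_zero (mul_ne_zero (mul_ne_zero hn hu) hSV) hSW) hcV,
    padicValRat.mul (mul_ne_zero (mul_ne_zero hn hu) hSV) hSW,
    padicValRat.mul (mul_ne_zero hn hu) hSV, padicValRat.mul hn hu]
  simp only [padicValRat.pow, padicValRat.of_nat, hnv, hTam, hSha, hMW]
  push_cast
  ring

end SumFibre

end Summit.BirchSwinnertonDyer.Rank1Residual.Additive

end
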